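import Mathlib
import Summits.NavierStokesRegularity.NavierStokesRegularity.Theorems.FilamentSkeletonRssDefectColumnGateDefs
import Literature.Analysis.FluidPDE.WholeSpaceIBP

/-!
# Route `FilamentSkeletonRss` · crux `TransverseReduction1AG` (stmt-27853) · line `defect_column_gate_1AG` — the FROZEN WAIST COLUMN MODEL
# of stub S2a `WaistColumnGate1A` is a legitimate base: smooth and DIVERGENCE FREE

Helper file (theorems only, `--supports stmt-NavierStokesRegularity-27853 --as helper`), first groundwork for the kill-first #2 stub S2a
(LEAD of 27853, lane ns-filament-21221-p1 g9).  HONEST FRAMING: sanity lemmas about the MODEL base field of a HYPOTHETICAL filament-type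
rotating-self-similar blow-up route (MODEL rung, negative side); no stub is proved; nothing here bears on Navier–Stokes regularity.

* `contDiff_colSwirl`, `contDiff_colBase` — the Gaussian column swirl `colSwirl gam Rc d` and the frozen waist model base
  `colBase B α gam Rc d = B y − ½y + α e₃×y + colSwirl` are `C^∞` (entire profile `burgersPhi`);
* `isDivFree_colSwirl` — `div colSwirl = 0` for EVERY axis `d` (the swirl is `f(|y|² − ⟨y,d⟩²)·(d × y)`: `d × y` is trace-free and
  `⟨d × y, ∇f⟩ = 0` because `∇f ∈ span{y, d}`);
* `divergence_colBase` — `div colBase = tr B − 3/2`;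
* `isDivFree_colBase` — under the S2a frame hypotheses (`(d; m, n)` orthonormal, `B d = κ d`, `⟨Bm,m⟩ + ⟨Bn,n⟩ = 3/2 − κ`) one has
  `tr B = 3/2`, so the model base is divergence free — the frozen waist model IS an admissible (solenoidal) base for `lerayLin`.
-/

set_option linter.dupNamespace false

noncomputable section

namespace Summit.NavierStokesRegularity.NavierStokesRegularity.Theorems.DefectColumnGate

open scoped BigOperators Topology InnerProductSpace ContDiff
open Filter Set Function MeasureTheory
open Literature.Analysis.FluidPDE
open Summit.NavierStokesRegularity.NavierStokesRegularity.Theorems.KelvinGate (lerayOp lerayLin XBound YBound LocClose)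

/-! ## Cross-product bookkeeping (private copies of standard coordinate facts) -/

/-- First coordinate of `cross u v`. -/
private theorem cross_apply_zero' (u v : EuclideanSpace ℝ (Fin 3)) : cross u v 0 = u 1 * v 2 - u 2 * v 1 := by
  simp [cross, cross_apply]

/-- Second coordinate of `cross u v`. -/
private theorem cross_apply_one' (u v : EuclideanSpace ℝ (Fin 3)) : cross u v 1 = u 2 * v 0 - u 0 * v 2 := by
  simp [cross, cross_apply]

/-- Third coordinate of `cross u v`. -/
private theorem cross_apply_two' (u v : EuclideanSpace ℝ (Fin 3)) : cross u v 2 = u 0 * v 1 - u 1 * v 0 := by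
  simp [cross, cross_apply]

/-- Coordinate formula for the inner product of `ℝ³`. -/
private theorem inner_three' (x y : EuclideanSpace ℝ (Fin 3)) : ⟪x, y⟫_ℝ = x 0 * y 0 + x 1 * y 1 + x 2 * y 2 := by
  rw [EuclideanSpace.inner_eq_star_dotProduct, star_trivial, dotProduct, Fin.sum_univ_three]
  ring

/-- `(d × y) · y = 0`. -/
private theorem inner_cross_arg_right (d y : EuclideanSpace ℝ (Fin 3)) : ⟪cross d y, y⟫_ℝ = 0 := by
  rw [inner_three', cross_apply_zero', cross_apply_one', cross_apply_two']; ring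

/-- `(d × y) · d = 0`. -/
private theorem inner_cross_arg_left (d y : EuclideanSpace ℝ (Fin 3)) : ⟪cross d y, d⟫_ℝ = 0 := by
  rw [inner_three', cross_apply_zero', cross_apply_one', cross_apply_two']; ring

/-- `y · (d × y) = 0`. -/
private theorem inner_arg_cross_right (d y : EuclideanSpace ℝ (Fin 3)) : ⟪y, cross d y⟫_ℝ = 0 := by
  rw [inner_three', cross_apply_zero', cross_apply_one', cross_apply_two']; ring

/-- `d · (d × y) = 0`. -/
private theorem inner_arg_cross_left (d y : EuclideanSpace ℝ (Fin 3)) : ⟪d, cross d y⟫_ℝ = 0 := by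
  rw [inner_three', cross_apply_zero', cross_apply_one', cross_apply_two']; ring

/-- `e_i · (d × e_i) = 0` summed over the standard basis: the linear map `y ↦ d × y` is trace free. -/
theorem trace_crossCLM (d : EuclideanSpace ℝ (Fin 3)) :
    LinearMap.trace ℝ _ ((crossCLM d : EuclideanSpace ℝ (Fin 3) →L[ℝ] EuclideanSpace ℝ (Fin 3)) :
      EuclideanSpace ℝ (Fin 3) →ₗ[ℝ] EuclideanSpace ℝ (Fin 3)) = 0 := by
  rw [LinearMap.trace_eq_sum_inner _ (EuclideanSpace.basisFun (Fin 3) ℝ)]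
  refine Finset.sum_eq_zero fun i _ => ?_
  simp only [ContinuousLinearMap.coe_coe, crossCLM_apply]
  rw [real_inner_comm]
  exact inner_cross_arg_right d _

/-! ## Smoothness -/

/-- The sectional quadratic form `y ↦ gam (|y|² − ⟨y,d⟩²)/4` is smooth. -/
theorem contDiff_colSwirlArg (gam : ℝ) (d : EuclideanSpace ℝ (Fin 3)) {n : WithTop ℕ∞} :
    ContDiff ℝ n (fun y : EuclideanSpace ℝ (Fin 3) => gam * (‖y‖ ^ 2 - ⟪y, d⟫_ℝ ^ 2) / 4) :=
  ((contDiff_const.mul ((contDiff_norm_sq ℝ).sub ((contDiff_id.inner ℝ contDiff_const).pow 2))).div_const _)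

/-- The column swirl as a scalar multiple of the linear field `y ↦ d × y`. -/
theorem colSwirl_eq (gam Rc : ℝ) (d : EuclideanSpace ℝ (Fin 3)) :
    colSwirl gam Rc d = fun y => (gam * Rc / (8 * Real.pi) * burgersPhi (gam * (‖y‖ ^ 2 - ⟪y, d⟫_ℝ ^ 2) / 4)) • crossCLM d y := by
  funext y; simp [colSwirl, crossCLM_apply]

/-- **The Gaussian column swirl is smooth on all of `ℝ³`** (every axis `d`). -/
theorem contDiff_colSwirl (gam Rc : ℝ) (d : EuclideanSpace ℝ (Fin 3)) {n : WithTop ℕ∞} : ContDiff ℝ n (colSwirl gam Rc d) := by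
  rw [colSwirl_eq]
  exact (contDiff_const.mul (contDiff_burgersPhi.comp (contDiff_colSwirlArg gam d))).smul (crossCLM d).contDiff

/-- The frozen waist model base is smooth. -/
theorem contDiff_colBase (B : EuclideanSpace ℝ (Fin 3) →L[ℝ] EuclideanSpace ℝ (Fin 3)) (α gam Rc : ℝ) (d : EuclideanSpace ℝ (Fin 3))
    {n : WithTop ℕ∞} : ContDiff ℝ n (colBase B α gam Rc d) := by
  have h1 : ContDiff ℝ n (fun y : EuclideanSpace ℝ (Fin 3) => cross (EuclideanSpace.single 2 1) y) := by
    have e : (fun y : EuclideanSpace ℝ (Fin 3) => cross (EuclideanSpace.single 2 1) y) = fun y => crossCLM (EuclideanSpace.single 2 1) y := by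
      funext y; simp [crossCLM_apply]
    rw [e]; exact (crossCLM _).contDiff
  unfold colBase
  exact ((B.contDiff.sub (contDiff_id.const_smul _)).add (h1.const_smul α)).add (contDiff_colSwirl gam Rc d)

/-! ## Divergence -/

/-- The derivative of the sectional quadratic form `q(y) = gam(|y|² − ⟨y,d⟩²)/4`. -/
theorem hasFDerivAt_colSwirlArg (gam : ℝ) (d y : EuclideanSpace ℝ (Fin 3)) :
    HasFDerivAt (fun y : EuclideanSpace ℝ (Fin 3) => gam * (‖y‖ ^ 2 - ⟪y, d⟫_ℝ ^ 2) / 4)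
      ((gam / 4) • ((2:ℝ) • innerSL ℝ y - (2 * ⟪y, d⟫_ℝ) • innerSL ℝ d)) y := by
  have h1 : HasFDerivAt (fun y : EuclideanSpace ℝ (Fin 3) => ‖y‖ ^ 2) ((2:ℝ) • innerSL ℝ y) y := by
    have h := (hasStrictFDerivAt_norm_sq y).hasFDerivAt
    rw [show (2:ℝ) • innerSL ℝ y = (2:ℕ) • innerSL ℝ y by
      rw [show (2:ℝ) = ((2:ℕ):ℝ) by norm_num, Nat.cast_smul_eq_nsmul]]
    exact h
  have h2 : HasFDerivAt (fun y : EuclideanSpace ℝ (Fin 3) => ⟪y, d⟫_ℝ) (innerSL ℝ d) y := by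
    have e : (fun y : EuclideanSpace ℝ (Fin 3) => ⟪y, d⟫_ℝ) = fun y => innerSL ℝ d y := by
      funext y; rw [innerSL_apply_apply, real_inner_comm]
    rw [e]; exact (innerSL ℝ d).hasFDerivAt
  have h3 : HasFDerivAt (fun y : EuclideanSpace ℝ (Fin 3) => ⟪y, d⟫_ℝ ^ 2) ((2 * ⟪y, d⟫_ℝ) • innerSL ℝ d) y := by
    have := h2.pow 2
    simpa using this
  have e : (fun y : EuclideanSpace ℝ (Fin 3) => gam * (‖y‖ ^ 2 - ⟪y, d⟫_ℝ ^ 2) / 4) =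
      fun y => (gam / 4) * (‖y‖ ^ 2 - ⟪y, d⟫_ℝ ^ 2) := by
    funext y; ring
  rw [e]
  exact (h1.sub h3).const_mul (gam / 4)

/-- … and it kills the swirl direction: `Dq(y)[d × y] = 0` (`y ⟂ d × y`, `d ⟂ d × y`). -/
theorem colSwirlArg_deriv_cross (gam : ℝ) (d y : EuclideanSpace ℝ (Fin 3)) :
    ((gam / 4) • ((2:ℝ) • innerSL ℝ y - (2 * ⟪y, d⟫_ℝ) • innerSL ℝ d)) (cross d y) = 0 := by
  have e : ((gam / 4) • ((2:ℝ) • innerSL ℝ y - (2 * ⟪y, d⟫_ℝ) • innerSL ℝ d)) (cross d y) =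
      (gam / 4) * ((2:ℝ) * ⟪y, cross d y⟫_ℝ - (2 * ⟪y, d⟫_ℝ) * ⟪d, cross d y⟫_ℝ) := rfl
  rw [e, inner_arg_cross_right, inner_arg_cross_left]
  ring

/-- **The Gaussian column swirl is divergence free** (every axis `d`, every `gam, Rc`). -/
theorem isDivFree_colSwirl (gam Rc : ℝ) (d : EuclideanSpace ℝ (Fin 3)) : VectorCalculus.IsDivFree (colSwirl gam Rc d) := by
  intro y
  rw [colSwirl_eq]
  -- the scalar factor and its derivative
  have hq := hasFDerivAt_colSwirlArg gam d y
  have hφ : HasDerivAt burgersPhi (deriv burgersPhi (gam * (‖y‖ ^ 2 - ⟪y, d⟫_ℝ ^ 2) / 4)) (gam * (‖y‖ ^ 2 - ⟪y, d⟫_ℝ ^ 2) / 4) :=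
    (((contDiff_burgersPhi (n := 1)).differentiable one_ne_zero) _).hasDerivAt
  have hθ : HasFDerivAt (fun y : EuclideanSpace ℝ (Fin 3) => gam * Rc / (8 * Real.pi) * burgersPhi (gam * (‖y‖ ^ 2 - ⟪y, d⟫_ℝ ^ 2) / 4))
      ((gam * Rc / (8 * Real.pi)) • (deriv burgersPhi (gam * (‖y‖ ^ 2 - ⟪y, d⟫_ℝ ^ 2) / 4) •
        ((gam / 4) • ((2:ℝ) • innerSL ℝ y - (2 * ⟪y, d⟫_ℝ) • innerSL ℝ d)))) y :=
    (hφ.comp_hasFDerivAt y hq).const_mul _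
  have hu : DifferentiableAt ℝ (fun y : EuclideanSpace ℝ (Fin 3) => crossCLM d y) y := (crossCLM d).differentiableAt
  rw [divergence_smul_apply hθ.differentiableAt hu]
  have hdivL : VectorCalculus.divergence (fun y : EuclideanSpace ℝ (Fin 3) => crossCLM d y) y = 0 := by
    rw [VectorCalculus.divergence, show (fun y : EuclideanSpace ℝ (Fin 3) => crossCLM d y) = (crossCLM d : _ → _) from rfl,
      ContinuousLinearMap.fderiv, trace_crossCLM]
  rw [hdivL, mul_zero, zero_add]
  -- `⟨d × y, ∇θ(y)⟩ = Dθ(y)[d × y] = c · φ′ · Dq(y)[d × y] = 0`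
  rw [real_inner_comm]
  unfold gradient
  rw [InnerProductSpace.toDual_symm_apply, hθ.fderiv, crossCLM_apply]
  rw [show ∀ (c₁ c₂ : ℝ) (L : EuclideanSpace ℝ (Fin 3) →L[ℝ] ℝ) (v : EuclideanSpace ℝ (Fin 3)), (c₁ • (c₂ • L)) v = c₁ * (c₂ * L v)
    from fun _ _ _ _ => rfl, colSwirlArg_deriv_cross, mul_zero, mul_zero]

/-- `div(y ↦ ½ y) = 3/2` on `ℝ³`. -/
theorem divergence_half_smul (x : EuclideanSpace ℝ (Fin 3)) :
    VectorCalculus.divergence (fun y : EuclideanSpace ℝ (Fin 3) => (1/2:ℝ) • y) x = 3 / 2 := by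
  have h : (fderiv ℝ (fun y : EuclideanSpace ℝ (Fin 3) => (1/2:ℝ) • y) x :
      EuclideanSpace ℝ (Fin 3) →ₗ[ℝ] EuclideanSpace ℝ (Fin 3)) = (1/2:ℝ) • LinearMap.id := by
    rw [show (fun y : EuclideanSpace ℝ (Fin 3) => (1/2:ℝ) • y) =
      (((1/2:ℝ) • ContinuousLinearMap.id ℝ (EuclideanSpace ℝ (Fin 3)) : EuclideanSpace ℝ (Fin 3) →L[ℝ] EuclideanSpace ℝ (Fin 3)) :
        EuclideanSpace ℝ (Fin 3) → EuclideanSpace ℝ (Fin 3)) from rfl, ContinuousLinearMap.fderiv]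
    ext v
    simp
  rw [VectorCalculus.divergence, h, map_smul, LinearMap.trace_id, finrank_euclideanSpace_fin]
  norm_num

/-- **`div colBase = tr B − 3/2`** (the rotation `α e₃ × y` and the column swirl are divergence free). -/
theorem divergence_colBase (B : EuclideanSpace ℝ (Fin 3) →L[ℝ] EuclideanSpace ℝ (Fin 3)) (α gam Rc : ℝ) (d y : EuclideanSpace ℝ (Fin 3)) :
    VectorCalculus.divergence (colBase B α gam Rc d) y =
      LinearMap.trace ℝ _ (B : EuclideanSpace ℝ (Fin 3) →ₗ[ℝ] EuclideanSpace ℝ (Fin 3)) - 3 / 2 := by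
  have e : colBase B α gam Rc d = fun y => ((B y - (1/2:ℝ) • y) + α • crossCLM (EuclideanSpace.single 2 1) y) + colSwirl gam Rc d y := by
    funext y; simp [colBase, crossCLM_apply]
  rw [e]
  have hB : DifferentiableAt ℝ (fun y : EuclideanSpace ℝ (Fin 3) => B y) y := B.differentiableAt
  have hy : DifferentiableAt ℝ (fun y : EuclideanSpace ℝ (Fin 3) => (1/2:ℝ) • y) y := by fun_prop
  have hJ : DifferentiableAt ℝ (fun y : EuclideanSpace ℝ (Fin 3) => crossCLM (EuclideanSpace.single 2 1) y) y :=
    (crossCLM _).differentiableAt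
  have hαJ : DifferentiableAt ℝ (fun y : EuclideanSpace ℝ (Fin 3) => α • crossCLM (EuclideanSpace.single 2 1) y) y := by fun_prop
  have h12 : DifferentiableAt ℝ (fun y : EuclideanSpace ℝ (Fin 3) => B y - (1/2:ℝ) • y) y := by fun_prop
  have h123 : DifferentiableAt ℝ (fun y : EuclideanSpace ℝ (Fin 3) => B y - (1/2:ℝ) • y + α • crossCLM (EuclideanSpace.single 2 1) y) y := by
    fun_prop
  have hS : DifferentiableAt ℝ (colSwirl gam Rc d) y := ((contDiff_colSwirl gam Rc d (n := 1)).differentiable one_ne_zero) y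
  rw [divergence_add_apply h123 hS, divergence_add_apply h12 hαJ, divergence_sub_apply hB hy,
    divergence_const_smul_apply hJ, divergence_half_smul, isDivFree_colSwirl gam Rc d y]
  have hdivJ : VectorCalculus.divergence (fun y : EuclideanSpace ℝ (Fin 3) => crossCLM (EuclideanSpace.single 2 1) y) y = 0 := by
    rw [VectorCalculus.divergence, show (fun y : EuclideanSpace ℝ (Fin 3) => crossCLM (EuclideanSpace.single 2 1) y) =
      (crossCLM (EuclideanSpace.single 2 1) : _ → _) from rfl, ContinuousLinearMap.fderiv, trace_crossCLM]
  have hdivB : VectorCalculus.divergence (fun y : EuclideanSpace ℝ (Fin 3) => B y) y =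
      LinearMap.trace ℝ _ (B : EuclideanSpace ℝ (Fin 3) →ₗ[ℝ] EuclideanSpace ℝ (Fin 3)) := by
    rw [VectorCalculus.divergence, show (fun y : EuclideanSpace ℝ (Fin 3) => B y) = (B : _ → _) from rfl, ContinuousLinearMap.fderiv]
  rw [hdivJ, hdivB]
  ring

/-- The trace of `B` in the orthonormal frame `(d; m, n)` with `B d = κ d` and sectional trace `3/2 − κ` is `3/2`. -/
theorem trace_eq_of_frame {B : EuclideanSpace ℝ (Fin 3) →L[ℝ] EuclideanSpace ℝ (Fin 3)} {d m n : EuclideanSpace ℝ (Fin 3)} {κ : ℝ}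
    (hon : Orthonormal ℝ ![d, m, n]) (hBd : B d = κ • d) (htr : ⟪B m, m⟫_ℝ + ⟪B n, n⟫_ℝ = 3/2 - κ) :
    LinearMap.trace ℝ _ (B : EuclideanSpace ℝ (Fin 3) →ₗ[ℝ] EuclideanSpace ℝ (Fin 3)) = 3 / 2 := by
  -- the frame is an orthonormal basis of `ℝ³`
  have hcard : Fintype.card (Fin 3) = Module.finrank ℝ (EuclideanSpace ℝ (Fin 3)) := by simp
  have hcoe : ((basisOfOrthonormalOfCardEqFinrank hon hcard : Module.Basis (Fin 3) ℝ (EuclideanSpace ℝ (Fin 3))) : Fin 3 → _) = ![d, m, n] :=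
    coe_basisOfOrthonormalOfCardEqFinrank hon hcard
  have hon' : Orthonormal ℝ (basisOfOrthonormalOfCardEqFinrank hon hcard : Module.Basis (Fin 3) ℝ (EuclideanSpace ℝ (Fin 3))) := by
    rw [hcoe]; exact hon
  let b : OrthonormalBasis (Fin 3) ℝ (EuclideanSpace ℝ (Fin 3)) := (basisOfOrthonormalOfCardEqFinrank hon hcard).toOrthonormalBasis hon'
  have hb : ∀ i, b i = ![d, m, n] i := fun i => by
    have h := congrFun hcoe i
    simp only [b, Module.Basis.coe_toOrthonormalBasis]
    exact h
  rw [LinearMap.trace_eq_sum_inner _ b, Fin.sum_univ_three]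
  simp only [ContinuousLinearMap.coe_coe, hb]
  simp only [Matrix.cons_val_zero, Matrix.cons_val_one, Matrix.cons_val_two, Matrix.head_cons, Matrix.tail_cons]
  have hd1 : ⟪d, d⟫_ℝ = 1 := by
    have := hon.1 0
    simp only [Matrix.cons_val_zero] at this
    rw [real_inner_self_eq_norm_sq, this]; norm_num
  rw [hBd, inner_smul_right, hd1, mul_one, real_inner_comm (B m), real_inner_comm (B n)]
  linarith

/-- **THE FROZEN WAIST MODEL BASE IS DIVERGENCE FREE** under the frame hypotheses of stub S2a. -/
theorem isDivFree_colBase {B : EuclideanSpace ℝ (Fin 3) →L[ℝ] EuclideanSpace ℝ (Fin 3)} {d m n : EuclideanSpace ℝ (Fin 3)} {κ : ℝ}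
    (hon : Orthonormal ℝ ![d, m, n]) (hBd : B d = κ • d) (htr : ⟪B m, m⟫_ℝ + ⟪B n, n⟫_ℝ = 3/2 - κ) (α gam Rc : ℝ) :
    VectorCalculus.IsDivFree (colBase B α gam Rc d) := by
  intro y
  rw [divergence_colBase, trace_eq_of_frame hon hBd htr]
  norm_num

end Summit.NavierStokesRegularity.NavierStokesRegularity.Theorems.DefectColumnGate

end
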